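import Mathlib
import HarnessLib

/-!
# Risk composition for data-built certificates: if the calibration data are independent of the run and put the inputs on the safe
# side except with probability `δ_cal`, the data-built error bar fails with probability at most `δ + δ_cal`

HONEST FRAMING: exact (Metropolis-corrected) sampling algorithms for lattice gauge theory;
figures of merit are autocorrelation/cost numbers at stated couplings and volumes; no
continuum-physics claim.

Venture `LatticeQCDFlow` (cell pub-lqcd), topic `Exactness`; FANOUT row 30 (lean-1, GEN-41).  NEW WORK of the cell, generic measure
theory over Mathlib — the glue that turns GEN-41's `IMHCertificateCalibration` ∕ `IMHNormaliserBracketFromTwoSamples` ∕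
`ClippedReweightingCertificate` (bars valid with certified NUMBERS in place of oracle inputs) into single probability statements.  The
bars have the shape «for inputs on the safe side of the truth, `P_run(error ≥ radius(inputs)) ≤ δ`»; the inputs are built from
calibration data `d` (proposal and target samples) INDEPENDENT of the production run, and are on the safe side except on an event of
probability `≤ δ_cal` (one-sided Hoeffding bars).  On the product space of data and run:

* §1 **`prod_apply_le_of_sections`** — `(P ⊗ μ)(S) ≤ δ·P(D) + μ(Ω')·P(OKᶜ)` (`ℝ≥0∞`) whenever every section `S_d`, `d ∈ OK`, has
  `μ(S_d) ≤ δ` (`S` measurable; `OK` arbitrary); **`prod_real_apply_le_of_sections`** — probability measures: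
  `(P ⊗ μ)(S) ≤ δ + P(OKᶜ)` in `ℝ`.
* §2 **`prod_real_dataRadius_le`** — THE DATA-BUILT BAR: for a measurable statistic `T` of the run, a target value `θ` and a measurable
  data-built radius `r(d)`: if `P_run(|T − θ| ≥ r(d)) ≤ δ` for every `d ∈ OK`, then `(P ⊗ μ){(d, ω) : |T(ω) − θ| ≥ r(d)} ≤ δ + P(OKᶜ)`;
  **`prod_real_dataRadius_le_of_monotone`** — the form used in practice: an ORACLE radius `r⋆` with `P_run(|T − θ| ≥ r⋆) ≤ δ` and a
  data-built radius that DOMINATES it on `OK` (`r⋆ ≤ r(d)` for `d ∈ OK` — the calibration succeeded) give the same conclusion.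
Reading: «total risk = the bar's `δ` plus the calibration risks» is a theorem, not a slogan, provided the calibration sample is independent
of the production replicas (fresh proposals ∕ a separate target run); re-using the production proposals for calibration is NOT covered.
No `sorry`, no new definitions, nothing cited as a fact.
-/

noncomputable section

namespace Summit.Ventures.LatticeQCDFlow.Exactness

open MeasureTheory Set
open scoped ENNReal

variable {D : Type*} [MeasurableSpace D] {P : Measure D} {Ω' : Type*} [MeasurableSpace Ω'] {μ : Measure Ω'}

/-! ## §1 Sections small on `OK` ⇒ the product set is small up to `P(OKᶜ)` -/

/-- **`(P ⊗ μ)(S) ≤ δ·P(D) + μ(Ω')·P(OKᶜ)`** when `μ(S_d) ≤ δ` for every `d ∈ OK` (`S` measurable, `μ` s-finite; `OK` any set). [ours] -/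
theorem prod_apply_le_of_sections [SFinite μ] [SFinite P] {S : Set (D × Ω')} (hS : MeasurableSet S) {OK : Set D} {δ : ℝ≥0∞}
    (h : ∀ d ∈ OK, μ (Prod.mk d ⁻¹' S) ≤ δ) :
    (P.prod μ) S ≤ δ * P univ + μ univ * P OKᶜ := by
  rw [Measure.prod_apply hS]
  have hpt : ∀ d, μ (Prod.mk d ⁻¹' S) ≤ δ + OKᶜ.indicator (fun _ => μ univ) d := by
    intro d
    by_cases hd : d ∈ OK
    · rw [indicator_of_notMem (show d ∉ OKᶜ from fun h' => h' hd), add_zero]; exact h d hd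
    · rw [indicator_of_mem (show d ∈ OKᶜ from hd)]
      exact (measure_mono (subset_univ _)).trans le_add_self
  calc ∫⁻ d, μ (Prod.mk d ⁻¹' S) ∂P ≤ ∫⁻ d, (δ + OKᶜ.indicator (fun _ => μ univ) d) ∂P := lintegral_mono hpt
    _ = ∫⁻ _, δ ∂P + ∫⁻ d, OKᶜ.indicator (fun _ => μ univ) d ∂P := lintegral_add_left measurable_const _
    _ ≤ δ * P univ + μ univ * P OKᶜ := by
        rw [lintegral_const]
        gcongr
        calc ∫⁻ d, OKᶜ.indicator (fun _ => μ univ) d ∂P ≤ ∫⁻ d in OKᶜ, μ univ ∂P := lintegral_indicator_le _ _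
          _ = μ univ * P OKᶜ := by rw [setLIntegral_const]

/-- **`(P ⊗ μ)(S) ≤ δ + P(OKᶜ)`** for probability measures, in `ℝ` (`δ ≥ 0`). [ours] -/
theorem prod_real_apply_le_of_sections [IsProbabilityMeasure μ] [IsProbabilityMeasure P] {S : Set (D × Ω')} (hS : MeasurableSet S)
    {OK : Set D} {δ : ℝ} (hδ : 0 ≤ δ) (h : ∀ d ∈ OK, μ.real (Prod.mk d ⁻¹' S) ≤ δ) :
    (P.prod μ).real S ≤ δ + P.real OKᶜ := by
  have h' : ∀ d ∈ OK, μ (Prod.mk d ⁻¹' S) ≤ ENNReal.ofReal δ := fun d hd =>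
    (ENNReal.le_ofReal_iff_toReal_le (measure_ne_top μ _) hδ).2 (h d hd)
  have hle := prod_apply_le_of_sections (P := P) (μ := μ) hS h'
  rw [measure_univ, measure_univ, mul_one, one_mul] at hle
  rw [measureReal_def, measureReal_def]
  calc ((P.prod μ) S).toReal ≤ (ENNReal.ofReal δ + P OKᶜ).toReal :=
        ENNReal.toReal_mono (ENNReal.add_ne_top.2 ⟨ENNReal.ofReal_ne_top, measure_ne_top P _⟩) hle
    _ = δ + (P OKᶜ).toReal := by rw [ENNReal.toReal_add ENNReal.ofReal_ne_top (measure_ne_top P _), ENNReal.toReal_ofReal hδ]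

/-! ## §2 Data-built radii -/

/-- The failure set of a data-built bar `{(d, ω) : r(d) ≤ |T(ω) − θ|}` is measurable for measurable `r`, `T`. [ours, bookkeeping] -/
theorem measurableSet_dataRadius {r : D → ℝ} (hr : Measurable r) {T : Ω' → ℝ} (hT : Measurable T) (θ : ℝ) :
    MeasurableSet {p : D × Ω' | r p.1 ≤ |T p.2 - θ|} :=
  measurableSet_le (hr.comp measurable_fst) ((hT.comp measurable_snd).sub_const θ).abs

/-- **THE DATA-BUILT BAR IS HONEST AT RISK `δ + P(OKᶜ)`**: calibration data `d ∼ P` independent of the run `ω ∼ μ` (product law);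
a measurable run statistic `T`, a value `θ`, a measurable data-built radius `r`; if `μ(|T − θ| ≥ r(d)) ≤ δ` for every `d ∈ OK` then
`(P ⊗ μ)(|T − θ| ≥ r(d)) ≤ δ + P(OKᶜ)`. [ours] -/
theorem prod_real_dataRadius_le [IsProbabilityMeasure μ] [IsProbabilityMeasure P] {r : D → ℝ} (hr : Measurable r) {T : Ω' → ℝ}
    (hT : Measurable T) (θ : ℝ) {OK : Set D} {δ : ℝ} (hδ : 0 ≤ δ) (h : ∀ d ∈ OK, μ.real {ω | r d ≤ |T ω - θ|} ≤ δ) :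
    (P.prod μ).real {p : D × Ω' | r p.1 ≤ |T p.2 - θ|} ≤ δ + P.real OKᶜ :=
  prod_real_apply_le_of_sections (measurableSet_dataRadius hr hT θ) hδ (fun d hd => by
    have : Prod.mk d ⁻¹' {p : D × Ω' | r p.1 ≤ |T p.2 - θ|} = {ω | r d ≤ |T ω - θ|} := rfl
    rw [this]; exact h d hd)

/-- **… FROM AN ORACLE BAR AND A DOMINATING DATA-BUILT RADIUS**: if `μ(|T − θ| ≥ r⋆) ≤ δ` (the certified bar with its oracle inputs) and the
calibration puts the data-built radius on the safe side, `r⋆ ≤ r(d)` for `d ∈ OK`, then `(P ⊗ μ)(|T − θ| ≥ r(d)) ≤ δ + P(OKᶜ)`. [ours] -/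
theorem prod_real_dataRadius_le_of_monotone [IsProbabilityMeasure μ] [IsProbabilityMeasure P] {r : D → ℝ} (hr : Measurable r)
    {T : Ω' → ℝ} (hT : Measurable T) (θ : ℝ) {OK : Set D} {rstar δ : ℝ} (hδ : 0 ≤ δ)
    (hbar : μ.real {ω | rstar ≤ |T ω - θ|} ≤ δ) (hOK : ∀ d ∈ OK, rstar ≤ r d) :
    (P.prod μ).real {p : D × Ω' | r p.1 ≤ |T p.2 - θ|} ≤ δ + P.real OKᶜ :=
  prod_real_dataRadius_le hr hT θ hδ fun d hd =>
    (measureReal_mono (fun ω (hω : r d ≤ |T ω - θ|) => (hOK d hd).trans hω)).trans hbar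

end Summit.Ventures.LatticeQCDFlow.Exactness
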